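import Mathlib
import Summits.NavierStokesRegularity.FluidComputer.TorusShellEnergyBudget
import Literature.Analysis.FluidPDE.NSGalerkinFourier
import Literature.Analysis.FluidPDE.TorusNSGevreyLattice
import Literature.Analysis.FluidPDE.NSUniqueness2HalfDEstimates
import HarnessLib

/-!
# Cascade LOCALITY in the kernel: the high band beyond `2M` is fed only by straining, the deposit reaches one octave

HONEST FRAMING (cell `ns-blowup`, seat `ns-blowup-circuit` g6, human ruling D-0035): nothing here is a
claim about Navier–Stokes blow-up. WHAT THIS IS NOT: not a regularity criterion, not blow-up evidence.
Part 8 of the `TorusHighBand*` files: the flux ceiling of part 1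
(`abs_integral_inner_highBand_convect_le`: `|∫⟪Q_M v,(v·∇)P_M v⟫| ≤ K_M(v)‖Q_M v‖₂‖v‖₂`) is SPLIT
along `v = P_M v + Q_M v` in the transporting slot:

* DEPOSIT `∫⟪Q_M v, (P_M v·∇)P_M v⟫` — the low band's self-interaction `(P_M v·∇)P_M v` is a
  trigonometric polynomial with frequencies `|k| ≤ 2M` (`mFourierCoeff_convect_fourierTruncate_eq_zero`:
  sumset of the ball, tree `Torus.mFourierCoeff_convect_realTrigPoly`), so only the NEXT OCTAVE
  `M < |k| ≤ 2M` of `Q_M v` is fed: `|deposit| ≤ K_M(v)·‖P_M v‖₂·‖P_{2M} v − P_M v‖₂`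
  (`abs_deposit_le`);
* STRAINING `∫⟪Q_M v, (Q_M v·∇)P_M v⟫` — quadratic in the high band: `≤ K_M(v)·‖Q_M v‖₂²`
  (`abs_strain_le`);
* hence the **LOCALITY CEILING** `|∫⟪Q_M v,(v·∇)P_M v⟫| ≤ K_M(v)·(‖P_M v‖₂‖S_{M,2M} v‖₂ + ‖Q_M v‖₂²)`
  (`abs_integral_inner_highBand_convect_le_local`), with `S_{M,2M} v = P_{2M} v − P_M v`.

READING (memo `CIRCUIT-OBSTRUCTIONS.md` §E.2 — inter-octave triads — and the Galerkin GAP LEMMA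
`GalerkinGapTransfer`, p439143, now for NS itself): energy enters the band above wavenumber `M` of a
real periodic flow either by DEPOSIT into the next octave only (rate ≤ low-band strain × low-band
amplitude × next-octave amplitude) or by STRAINING of what the high band already holds (rate ≤
`K_M‖Q_M v‖²`, i.e. exponential at rate ≤ `2K_M` for the energy); across an empty octave (a spectral
gap of ratio 2) the transfer is pure straining — the true-NS twin of the Galerkin gap lemma. Plugged
into the budgets of parts 1–2 and 7 slice-wise. No definitions.
-/

noncomputable section

open MeasureTheory Set Filter UnitAddTorus Function
open scoped ENNReal NNReal InnerProductSpace RealInnerProductSpace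

namespace Summit.NavierStokesRegularity.FluidComputer.TorusHighBandFluxCeiling

open Literature.Analysis Literature.Analysis.FunctionSpaces Literature.Analysis.FluidPDE

variable {d : Type*} [Fintype d] [DecidableEq d]

section Locality

variable {v : UnitAddTorus d → EuclideanSpace ℝ d}

/-- **The low band's self-interaction lives below `2M`**: for integrable `v` and every frequency `k`
with `|k|² > (2M)²`, `𝓕((P_M v·∇)P_M v)(k) = 0` (the convective term of two trigonometric polynomials
on the ball `|l| ≤ M` has frequencies in the sumset `|l + m| ≤ 2M`). [folklore] -/
theorem mFourierCoeff_convect_fourierTruncate_eq_zero (hv : Integrable v volume) (M : ℕ) {k : d → ℤ}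
    (hk : ((2 * M : ℕ) : ℝ) ^ 2 < Torus.freqNormSq k) :
    mFourierCoeff (EuclideanSpace.complexify ∘
      Torus.convect (Torus.fourierTruncate M v) (Torus.fourierTruncate M v)) k = 0 := by
  classical
  rw [Torus.fourierTruncate_eq, FluidPDE.Torus.mFourierCoeff_convect_realTrigPoly
    Torus.neg_mem_freqBall_of_mem (Torus.isConjSymm_mFourierCoeff hv) (Torus.isConjSymm_mFourierCoeff hv),
    FluidPDE.Torus.convectionCoeff_def]
  refine Finset.sum_eq_zero fun l hl => Finset.sum_eq_zero fun m hm => ?_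
  rw [if_neg]
  intro hlm
  have hl' : Real.sqrt (Torus.freqNormSq l) ≤ M := by
    rw [← Real.sqrt_sq (Nat.cast_nonneg M)]; exact Real.sqrt_le_sqrt (Torus.mem_freqBall.1 hl)
  have hm' : Real.sqrt (Torus.freqNormSq m) ≤ M := by
    rw [← Real.sqrt_sq (Nat.cast_nonneg M)]; exact Real.sqrt_le_sqrt (Torus.mem_freqBall.1 hm)
  have htri := FluidPDE.NSGevrey.sqrt_freqNormSq_add_le l m
  rw [hlm] at htri
  have hk' : ((2 * M : ℕ) : ℝ) < Real.sqrt (Torus.freqNormSq k) := by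
    rw [← Real.sqrt_sq (Nat.cast_nonneg (2 * M))]
    exact Real.sqrt_lt_sqrt (sq_nonneg _) hk
  push_cast at hk'
  linarith

/-- The convective term of the low band against itself is pointwise bounded:
`‖(P_M v·∇)P_M v (x)‖ ≤ ‖P_M v x‖·K_M(v)`; hence `∫‖(P_M v·∇)P_M v‖² ≤ K_M(v)²·∫‖P_M v‖²`. [folklore] -/
theorem integral_norm_sq_convect_fourierTruncate_le (v : UnitAddTorus d → EuclideanSpace ℝ d) (M : ℕ) :
    ∫ x, ‖Torus.convect (Torus.fourierTruncate M v) (Torus.fourierTruncate M v) x‖ ^ 2 ≤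
      FluidPDE.Torus.truncDerivBound M v ^ 2 * ∫ x, ‖Torus.fourierTruncate M v x‖ ^ 2 := by
  rw [← integral_const_mul]
  have hK := FluidPDE.Torus.truncDerivBound_nonneg M v
  have hs : Torus.IsSmooth (Torus.convect (Torus.fourierTruncate M v) (Torus.fourierTruncate M v)) :=
    (Torus.isSmooth_fourierTruncate M v).convect (Torus.isSmooth_fourierTruncate M v)
  refine integral_mono_of_nonneg (ae_of_all _ fun x => by positivity)
    (((Torus.isSmooth_fourierTruncate M v).memLp 2).integrable_norm_pow two_ne_zero |>.const_mul _)
    (ae_of_all _ fun x => ?_)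
  have h := FluidPDE.Torus.norm_fderiv_fourierTruncate_apply_le M v x (Torus.fourierTruncate M v x)
  have h0 : 0 ≤ ‖Torus.convect (Torus.fourierTruncate M v) (Torus.fourierTruncate M v) x‖ := norm_nonneg _
  calc ‖Torus.convect (Torus.fourierTruncate M v) (Torus.fourierTruncate M v) x‖ ^ 2
      ≤ (‖Torus.fourierTruncate M v x‖ * FluidPDE.Torus.truncDerivBound M v) ^ 2 :=
        pow_le_pow_left₀ h0 h 2
    _ = FluidPDE.Torus.truncDerivBound M v ^ 2 * ‖Torus.fourierTruncate M v x‖ ^ 2 := by ring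

/-- `P_{2M} P_M v = P_M v`: the low band is band-limited to `2M`. [folklore] -/
theorem fourierTruncate_two_mul_fourierTruncate (hv : Integrable v volume) (M : ℕ) :
    Torus.fourierTruncate (2 * M) (Torus.fourierTruncate M v) = Torus.fourierTruncate M v := by
  classical
  refine Torus.fourierTruncate_eq_self (Torus.continuous_fourierTruncate M v) fun k hk => ?_
  rw [Torus.mFourierCoeff_fourierTruncate hv, if_neg]
  intro hkM
  have h1 : Torus.freqNormSq k ≤ (M : ℝ) ^ 2 := Torus.mem_freqBall.1 hkM
  have h2 : (M : ℝ) ^ 2 ≤ ((2 * M : ℕ) : ℝ) ^ 2 := by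
    push_cast; nlinarith [Nat.cast_nonneg (α := ℝ) M]
  linarith

/-- **DEPOSIT reaches one octave**: for `v ∈ L²(T^d)`,
`|∫⟪v − P_M v, (P_M v·∇)P_M v⟫| ≤ K_M(v) · ‖P_M v‖₂ · ‖P_{2M} v − P_M v‖₂`: the self-interaction of the
low band deposits energy only into the shell `M < |k| ≤ 2M`. [folklore] -/
theorem abs_deposit_le (hv : MemLp v 2 volume) (M : ℕ) :
    |∫ x, ⟪v x - Torus.fourierTruncate M v x,
        Torus.convect (Torus.fourierTruncate M v) (Torus.fourierTruncate M v) x⟫| ≤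
      FluidPDE.Torus.truncDerivBound M v * Real.sqrt (∫ x, ‖Torus.fourierTruncate M v x‖ ^ 2) *
        Real.sqrt (∫ x, ‖Torus.fourierTruncate (2 * M) v x - Torus.fourierTruncate M v x‖ ^ 2) := by
  classical
  set P := Torus.fourierTruncate M v with hP
  set W := Torus.convect P P with hW
  have hint : Integrable v volume := hv.integrable one_le_two
  have hPs : Torus.IsSmooth P := Torus.isSmooth_fourierTruncate M v
  have hWs : Torus.IsSmooth W := hPs.convect hPs
  have hWm : MemLp W 2 volume := hWs.memLp 2
  have hQm : MemLp (v - P) 2 volume := hv.sub (hPs.memLp 2)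
  -- the pairing only sees the modes of `v - P` below `2M`
  have hband : ∀ k ∉ Torus.freqBall (2 * M), mFourierCoeff (EuclideanSpace.complexify ∘ W) k = 0 := by
    intro k hk
    exact mFourierCoeff_convect_fourierTruncate_eq_zero hint M (Torus.not_mem_freqBall.1 hk)
  have hpair : ∫ x, ⟪(v - P) x, W x⟫ = ∫ x, ⟪Torus.fourierTruncate (2 * M) (v - P) x, W x⟫ :=
    (Torus.integral_inner_fourierTruncate_eq hQm hWm hband).symm
  have htr : Torus.fourierTruncate (2 * M) (v - P) = Torus.fourierTruncate (2 * M) v - P := by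
    rw [FluidPDE.Torus.fourierTruncate_sub hint hPs.integrable, hP, fourierTruncate_two_mul_fourierTruncate hint M]
  have hSm : MemLp (Torus.fourierTruncate (2 * M) v - P) 2 volume :=
    (Torus.memLp_fourierTruncate (2 * M) v 2).sub (hPs.memLp 2)
  -- Cauchy–Schwarz and the `L²` bound of `W`
  have h1 := abs_integral_inner_le_sqrt_mul_sqrt hSm hWm
  have hWle : Real.sqrt (∫ x, ‖W x‖ ^ 2) ≤
      FluidPDE.Torus.truncDerivBound M v * Real.sqrt (∫ x, ‖P x‖ ^ 2) := by
    have h := Real.sqrt_le_sqrt (integral_norm_sq_convect_fourierTruncate_le v M)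
    rwa [Real.sqrt_mul (sq_nonneg _), Real.sqrt_sq (FluidPDE.Torus.truncDerivBound_nonneg M v)] at h
  have hpt : (fun x => ⟪v x - P x, W x⟫) = fun x => ⟪(v - P) x, W x⟫ := by funext x; rfl
  rw [hpt, hpair, htr]
  simp only [Pi.sub_apply] at h1 ⊢
  calc |∫ x, ⟪Torus.fourierTruncate (2 * M) v x - P x, W x⟫|
      ≤ Real.sqrt (∫ x, ‖Torus.fourierTruncate (2 * M) v x - P x‖ ^ 2) * Real.sqrt (∫ x, ‖W x‖ ^ 2) := h1
    _ ≤ Real.sqrt (∫ x, ‖Torus.fourierTruncate (2 * M) v x - P x‖ ^ 2) *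
          (FluidPDE.Torus.truncDerivBound M v * Real.sqrt (∫ x, ‖P x‖ ^ 2)) :=
        mul_le_mul_of_nonneg_left hWle (Real.sqrt_nonneg _)
    _ = _ := by ring

/-- **STRAINING is quadratic in the high band**: `|∫⟪v − P_M v, ((v − P_M v)·∇)P_M v⟫| ≤ K_M(v)·∫‖v − P_M v‖²`.
[folklore] -/
theorem abs_strain_le (hv : MemLp v 2 volume) (M : ℕ) :
    |∫ x, ⟪v x - Torus.fourierTruncate M v x,
        Torus.convect (v - Torus.fourierTruncate M v) (Torus.fourierTruncate M v) x⟫| ≤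
      FluidPDE.Torus.truncDerivBound M v * ∫ x, ‖v x - Torus.fourierTruncate M v x‖ ^ 2 := by
  set P := Torus.fourierTruncate M v with hP
  have hQm : MemLp (v - P) 2 volume := hv.sub (Torus.memLp_fourierTruncate M v 2)
  have hK := FluidPDE.Torus.truncDerivBound_nonneg M v
  have hpt : ∀ x, ‖⟪v x - P x, Torus.convect (v - P) P x⟫‖ ≤
      FluidPDE.Torus.truncDerivBound M v * ‖(v - P) x‖ ^ 2 := by
    intro x; rw [Real.norm_eq_abs]
    calc |⟪v x - P x, Torus.convect (v - P) P x⟫| ≤ ‖v x - P x‖ * ‖Torus.convect (v - P) P x‖ :=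
          abs_real_inner_le_norm _ _
      _ ≤ ‖v x - P x‖ * (‖(v - P) x‖ * FluidPDE.Torus.truncDerivBound M v) := by
          gcongr; exact FluidPDE.Torus.norm_fderiv_fourierTruncate_apply_le M v x ((v - P) x)
      _ = FluidPDE.Torus.truncDerivBound M v * ‖(v - P) x‖ ^ 2 := by rw [Pi.sub_apply]; ring
  have hI : Integrable (fun x => FluidPDE.Torus.truncDerivBound M v * ‖(v - P) x‖ ^ 2) volume :=
    (hQm.integrable_norm_pow two_ne_zero).const_mul _
  rw [← Real.norm_eq_abs]
  refine (norm_integral_le_of_norm_le hI (ae_of_all _ hpt)).trans ?_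
  rw [integral_const_mul]
  simp only [Pi.sub_apply]
  rfl

/-- **THE LOCALITY CEILING.** For `v ∈ L²(T^d)` and every band edge `M`:
`|∫⟪Q_M v,(v·∇)P_M v⟫| ≤ K_M(v)·(‖P_M v‖₂·‖P_{2M}v − P_M v‖₂ + ‖Q_M v‖₂²)` — the transfer into the
band `|k| > M` is a DEPOSIT into the next octave plus STRAINING of what the band already holds;
beyond `2M` nothing is deposited. Across an empty octave the transfer is pure straining (the
true-Navier–Stokes twin of the Galerkin gap lemma `GalerkinGapTransfer.abs_shellTransfer_le_gap`). [folklore] -/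
theorem abs_integral_inner_highBand_convect_le_local (hv : MemLp v 2 volume) (M : ℕ) :
    |∫ x, ⟪v x - Torus.fourierTruncate M v x, Torus.convect v (Torus.fourierTruncate M v) x⟫| ≤
      FluidPDE.Torus.truncDerivBound M v *
        (Real.sqrt (∫ x, ‖Torus.fourierTruncate M v x‖ ^ 2) *
            Real.sqrt (∫ x, ‖Torus.fourierTruncate (2 * M) v x - Torus.fourierTruncate M v x‖ ^ 2) +
          ∫ x, ‖v x - Torus.fourierTruncate M v x‖ ^ 2) := by
  set P := Torus.fourierTruncate M v with hP
  have hPs : Torus.IsSmooth P := Torus.isSmooth_fourierTruncate M v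
  have hPm : MemLp P 2 volume := hPs.memLp 2
  have hQm : MemLp (v - P) 2 volume := hv.sub hPm
  -- split the transporting field: `(v·∇)P = (P·∇)P + ((v-P)·∇)P`
  have hsplit : ∀ x, Torus.convect v P x = Torus.convect P P x + Torus.convect (v - P) P x := by
    intro x
    unfold Torus.convect
    rw [← map_add]
    congr 1
    rw [Pi.sub_apply]; abel
  have hpt : ∀ x, ⟪v x - P x, Torus.convect v P x⟫ =
      ⟪v x - P x, Torus.convect P P x⟫ + ⟪v x - P x, Torus.convect (v - P) P x⟫ := by
    intro x; rw [hsplit, inner_add_right]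
  simp_rw [hpt]
  have i1 : Integrable (fun x => ⟪v x - P x, Torus.convect P P x⟫) volume := by
    have h := FluidPDE.Torus.integrable_inner_convect' hQm hPm hPs
    simpa only [Pi.sub_apply] using h
  have i2 : Integrable (fun x => ⟪v x - P x, Torus.convect (v - P) P x⟫) volume := by
    have h := FluidPDE.Torus.integrable_inner_convect' hQm hQm hPs
    simpa only [Pi.sub_apply] using h
  rw [integral_add i1 i2]
  have hd := abs_deposit_le hv M
  have hs := abs_strain_le hv M
  calc |(∫ x, ⟪v x - P x, Torus.convect P P x⟫) + ∫ x, ⟪v x - P x, Torus.convect (v - P) P x⟫|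
      ≤ |∫ x, ⟪v x - P x, Torus.convect P P x⟫| + |∫ x, ⟪v x - P x, Torus.convect (v - P) P x⟫| :=
        abs_add_le _ _
    _ ≤ _ := by rw [mul_add]; exact add_le_add (by simpa only [hP, mul_assoc] using hd) (by simpa only [hP] using hs)

end Locality

end Summit.NavierStokesRegularity.FluidComputer.TorusHighBandFluxCeiling
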